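import Summits.FinalStateConjecture.FinalStateConjecture.Theorems.ZeroEnergyKerrOrBombStationaryLimitReductionRecutCoveringJunctionCore
import Summits.FinalStateConjecture.FinalStateConjecture.Theorems.BartnikGapSettlingGapExhaustionChartSegmentChronological
import Literature.Geometry.Lorentzian.BackgroundChartCalculus
import Literature.Geometry.Lorentzian.TimeCones
import Literature.Geometry.Lorentzian.ConvergenceTransport
import Literature.Geometry.Lorentzian.MinkowskiGlobalHyperbolicity
import Literature.Geometry.Lorentzian.KerrSchildCoord
import Literature.Geometry.Lorentzian.KerrLeafEnergyComparison
import HarnessLib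

/-!
# Route ZeroEnergyKerrOrBomb · crux `FinalStateFromKerrOrBomb` (stmt-FinalStateConjecture-17839), line
# `SketchIdeator1` — stub `stub_recutJunctionCoreOriented`, ingredient (α): Kerr–Schild time lines in the
# certified hole tubes are future timelike; far tube points reach the recut slab

Helper file (`--supports stmt-FinalStateConjecture-17839`; registered helper `recutJunction_holeTube_far`) of the
lead's wave-3 stub worker (2026-08-17) for the ORIENTED junction core (`RecutJunctionCore` of
`…RecutCoveringJunctionCore.lean` with the orientation clauses (F5), (ii), (iii) inserted).

THE CHAIN (ingredient (α), one hole `i`, motion `P u = Λ u + c₀`, adapted chart `A`, Kerr identification `Θ`,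
old late chart `ψ = d.toOver.chart i` on the moved adapted domain). A point of the old d.o.c. tube is
`p = ψ ⟨P (Θ x), _⟩` with `x ∈ Kerr.exterior M a` its Kerr–Schild coordinate (anchor clause of
`IsKerrChartedWith`), chart time `σ = (Θ x)⁰` and adapted radius `A.radius (Θ x) ≤ R σ`. The Kerr–Schild
TIME LINE `s ↦ x + s e₀` is carried by `T`-equivariance to the chart line `s ↦ P (Θ x) + s (c Λ e₀)`
(`Θ (x + s e₀) = Θ x + (c s) e₀`), along which the chart time is `σ + c s`, the adapted radius is CONSTANT
(`AdaptedChart.radius_ofTimeSpace`) and the point stays in the d.o.c. part; since `R` is monotone the line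
stays in the certified tube `{radius ≤ R (time)}`, where `‖(ψ^* g − g_A ∘ P⁻¹)‖ < ε` for late `σ`
(hypothesis (i) of the core, `C⁰` part). Its velocity `dψ (c Λ e₀)` is
* TIMELIKE for `g_𝒟`: `g_A(Θ x)(c e₀, c e₀) = g_A(dΘ e₀, dΘ e₀) = g_{M,a}(x)(e₀, e₀) = −1 + 2H(x)` (isometry
  clause), `≤ −δ` OUTSIDE THE ERGOREGION WITH MARGIN `2H ≤ 1 − δ`, and `ε ‖c Λ e₀‖² < δ` (§3);
* FUTURE for `τ_𝒟` by clause (ii), whose premise "`dA (c e₀) = c T` is `𝓑ᵢ`-future at `A (Θ x)`" is §2: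
  `dA (dΘ V)`, `V = −g♯dt*`, is `𝓑ᵢ`-future by (F5) and timelike (`g(V, V) = −1 − 2H`), `dA (dΘ e₀)` is
  timelike (`−1 + 2H < 0`) and `g(dA dΘ V, dA dΘ e₀) = g_{M,a}(V, e₀) = −1 < 0` (timecone lemma).
Hence (`stub_chartSegment_chronological`, the tree's chart-segment glue) `ψ(P Θ (x + S e₀)) ∈ I⁺(p)` for
`S > 0` (§3, `kerrTimeLine_mem_chronologicalFuture`), and with `S = τ₁ − x⁰ ≥ 0` the endpoint is the recut
chart point of Kerr–Schild time `τ₁` and radius `r(x)`: a point of `recutCertifiedSlab … R' τ₁` as soon as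
`r(x) ≤ R' i τ₁` (§4, `recutJunction_holeTube_far`, `recutJunction_holeTube_far_slab`).

What this does NOT cover (worker report): tube points in the closed ergoregion `{2H ≥ 1}` (there `∂_{t*}`
is not timelike; the rotating field `T + ω(r)Φ` of the tree's `KerrTimelikeSpan.lean` would be needed, with
the identification `Θ` not known to be `Φ`-equivariant), tube points of Kerr–Schild time `> τ₁` or radius
`> R' i τ₁` outside the recut late region (they lie in the radiation zone with flat time `≤ τ₁`), and the
`J⁻(docHoleSlabs)` part: all of these reduce to the past-boundary property of the recut certified late
region, see the companion file `…RecutJunctionPastBoundary.lean`.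

Elementary; no named fact, nothing restated. References: Dafermos–Luk arXiv:1710.01722, Conjecture 1
(b)–(c); Dafermos–Rodnianski arXiv:0811.0354, §5.1 (`g(V, ·) = −dt*`, `g(V, V) = −1 − 2H`); O'Neill 1983,
Ch. 5, Lemma 5.29, p. 145 (timecones), Ch. 14, pp. 402–403.
-/

set_option linter.dupNamespace false

noncomputable section

open scoped Manifold ContDiff Topology ENNReal
open Set Filter Function Literature.Geometry.Lorentzian

namespace Summit.FinalStateConjecture.FinalStateConjecture.Theorems.SymplecticDualOfTheBomb

open Summit.FinalStateConjecture.FinalStateConjecture.Theorems.OneLockedExplosion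

/-! ## §1 Pointwise preliminaries -/

section Prelim

variable (𝓢 : Spacetime.{0} 4) (B : ModelBackground)

/-- Private copy of `norm_deviation_lt_of_truncDeviationCk_lt` (`…JunctionTimeFunction.lean`, unbuilt today):
`C⁰`-closeness on a truncated slab is pointwise closeness. [folklore] -/
private theorem norm_deviation_lt_of_truncDeviationCk_lt_w3 (ψ : B.domain → 𝓢.carrier) {k : ℕ} {R τ ε : ℝ}
    (hε : 0 < ε) (h : 𝓢.truncDeviationCk B ψ k R τ < ENNReal.ofReal ε) {x : B.domain}
    (hx : x ∈ B.truncTimeSlab R τ) : ‖𝓢.deviation B ψ x‖ < ε := by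
  have h2 := enorm_iteratedFDeriv_le_supCkENorm (Nat.zero_le k) (mem_image_of_mem Subtype.val hx)
    (𝓢.deviationExtend B ψ)
  rw [← ofReal_norm, norm_iteratedFDeriv_zero, 𝓢.deviationExtend_coe] at h2
  exact (ENNReal.ofReal_lt_ofReal_iff hε).1 (h2.trans_lt h)

/-- Private copy of `isTimelike_mfderiv_of_norm_deviation_le` (`…JunctionTimeFunction.lean`, unbuilt today): a
pinched chart pushes a background-timelike vector with margin to a timelike vector. [folklore] -/
private theorem isTimelike_mfderiv_of_norm_deviation_le_w3 (ψ : B.domain → 𝓢.carrier) {x : B.domain} {V : E4}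
    {ε : ℝ} (hdev : ‖𝓢.deviation B ψ x‖ ≤ ε) (hV : B.bilin x.1 V V + ε * ‖V‖ ^ 2 < 0) :
    𝓢.metric.IsTimelike (mfderiv 𝓘(ℝ, E4) (𝓡 4) ψ x V) := by
  have h1 : |𝓢.deviation B ψ x V V| ≤ ‖𝓢.deviation B ψ x‖ * ‖V‖ * ‖V‖ := by
    rw [← Real.norm_eq_abs]; exact (𝓢.deviation B ψ x).le_opNorm₂ V V
  have h2 : ‖𝓢.deviation B ψ x‖ * ‖V‖ * ‖V‖ ≤ ε * ‖V‖ ^ 2 := by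
    rw [pow_two, ← mul_assoc]
    exact mul_le_mul_of_nonneg_right (mul_le_mul_of_nonneg_right hdev (norm_nonneg V)) (norm_nonneg V)
  have h3 := (abs_le.1 (h1.trans h2)).2
  rw [Spacetime.deviation_apply] at h3
  show 𝓢.metric.val (ψ x) _ _ < 0
  linarith

end Prelim

/-! ## §2 The hole side: `dA (c e₀) = d(A ∘ Θ)(∂_{t*})` is future timelike outside the ergoregion -/

section Hole

variable {𝓑 : StationaryAFBlackHole.{0}} (A : 𝓑.AdaptedChart) {M a c r₀ : ℝ} {Θ : E4 → E4}

/-- **Outside the ergoregion the adapted image of `∂_{t*}` is future timelike.** Under `IsKerrChartedWith 𝓑 A M a c r₀ Θ`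
and future-preservation (F5) of `Θ`, at every `x ∈ Kerr.exterior M a` with `2H(x) < 1` the vector
`dA_{Θ x}(c e₀) = dA (dΘ_x e₀)` is `g_𝓑`-timelike and `τ_𝓑`-future: `g_𝓑(dA dΘ v, dA dΘ w) = g_{M,a}(x)(v, w)`
(`A.bilin = A^* g_𝓑`, isometry clause), so `dA dΘ V` (`V = −g♯dt*`, future by (F5)) and `dA dΘ e₀` are
timelike with `g = −1 ∓ 2H` and pair to `g_{M,a}(V, e₀) = −1 < 0` (timecone lemma, O'Neill 1983, Ch. 5,
Lemma 5.29). [folklore] -/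
theorem adapted_smul_basisVector_future (hW : IsKerrChartedWith 𝓑 A M a c r₀ Θ)
    (hF5 : ∀ u ∈ (Kerr.exterior M a : Set E4), ∀ h : Θ u ∈ A.domain,
      𝓑.timeOrientation.IsFutureDirected
        (mfderiv 𝓘(ℝ, E4) (𝓡 4) A.toFun ⟨Θ u, h⟩ (fderiv ℝ Θ u (Kerr.timeVector M a u))))
    {x : E4} (hx : x ∈ (Kerr.exterior M a : Set E4)) (hH : 2 * Kerr.scalarH M a x < 1) (h : Θ x ∈ A.domain) :
    𝓑.metric.IsTimelike (mfderiv 𝓘(ℝ, E4) (𝓡 4) A.toFun ⟨Θ x, h⟩ (c • E4.basisVector 0)) ∧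
      𝓑.timeOrientation.IsFutureDirected (mfderiv 𝓘(ℝ, E4) (𝓡 4) A.toFun ⟨Θ x, h⟩ (c • E4.basisVector 0)) := by
  obtain ⟨hsub, -, -, hr₀, hΘs, -, -, hΘe, hiso, -, -⟩ := hW
  have hxr : x ∈ (Kerr.region a r₀ : Set E4) :=
    Kerr.mem_region.2 ((max_le_max hr₀.le le_rfl).trans_lt (Kerr.mem_exterior.1 hx))
  have hrad : 0 < Kerr.radius a x := Kerr.radius_pos_of_mem_region hx
  have hdΘ : fderiv ℝ Θ x (E4.basisVector 0) = c • E4.basisVector 0 :=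
    fderiv_apply_basisVector_zero_of_contDiffOn (Kerr.region a r₀).isOpen (by simp) hΘs hΘe hxr
  -- the pullback identity `g_𝓑(dA dΘ v, dA dΘ w) = g_{M,a}(x)(v, w)`
  have hpb : ∀ v w : E4, 𝓑.metric.val (A.toFun ⟨Θ x, h⟩)
      (mfderiv 𝓘(ℝ, E4) (𝓡 4) A.toFun ⟨Θ x, h⟩ (fderiv ℝ Θ x v))
      (mfderiv 𝓘(ℝ, E4) (𝓡 4) A.toFun ⟨Θ x, h⟩ (fderiv ℝ Θ x w)) = Kerr.bilin M a x v w := by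
    intro v w
    rw [← hiso x hx v w, A.bilin_eq ⟨Θ x, h⟩]
    rfl
  have hXX : 𝓑.metric.IsTimelike (mfderiv 𝓘(ℝ, E4) (𝓡 4) A.toFun ⟨Θ x, h⟩ (fderiv ℝ Θ x (Kerr.timeVector M a x))) := by
    show 𝓑.metric.val _ _ _ < 0
    rw [hpb, Kerr.bilin_timeVector_timeVector hrad]
    linarith [Kerr.scalarH_nonneg hsub.pos.le a x]
  have hYY : 𝓑.metric.IsTimelike (mfderiv 𝓘(ℝ, E4) (𝓡 4) A.toFun ⟨Θ x, h⟩ (fderiv ℝ Θ x (E4.basisVector 0))) := by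
    show 𝓑.metric.val _ _ _ < 0
    rw [hpb, Kerr.bilin_basisVector_zero_basisVector_zero]
    linarith
  have hXY : 𝓑.metric.val (A.toFun ⟨Θ x, h⟩)
      (mfderiv 𝓘(ℝ, E4) (𝓡 4) A.toFun ⟨Θ x, h⟩ (fderiv ℝ Θ x (Kerr.timeVector M a x)))
      (mfderiv 𝓘(ℝ, E4) (𝓡 4) A.toFun ⟨Θ x, h⟩ (fderiv ℝ Θ x (E4.basisVector 0))) < 0 := by
    rw [hpb, Kerr.bilin_timeVector hrad]
    simp [E4.basisVector]
  rw [← hdΘ]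
  exact ⟨hYY, 𝓑.timeOrientation.isFutureDirected_of_val_lt_zero (hF5 x hx h) hXX hYY.isCausal hXY⟩

end Hole

/-! ## §3 The moved chart: Kerr–Schild time lines in the certified tube are future timelike -/

section Line

variable (𝓢 : Spacetime.{0} 4) {𝓑 : StationaryAFBlackHole.{0}} (A : 𝓑.AdaptedChart) (Λ : lorentzGroup) (c₀ : E4)
  {M a c r₀ : ℝ} {Θ : E4 → E4}

/-- **Kerr–Schild time lines in the certified tube are future timelike (one hole, general late chart).** Let
`IsKerrChartedWith 𝓑 A M a c r₀ Θ` with (F5), let `ψ` be a smooth chart on the moved adapted domain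
`(A, Λ, c₀)` satisfying the orientation clause (ii) after chart time `τ₀`, and let the `Cᵏ` deviation of `ψ^* g`
from the moved adapted background on the truncated slabs `{time = τ, radius ≤ R τ}` be `< ε` for `τ ≥ T`, `R`
monotone, `ε ‖c Λ e₀‖² < δ`. Then for `x ∈ Kerr.exterior M a` with `2H(x) ≤ 1 − δ`, chart time `(Θ x)⁰ ≥ T`,
`> τ₀`, adapted radius `A.radius (Θ x) ≤ R ((Θ x)⁰)`, and `S > 0`, the chart image of the Kerr–Schild time line
joins `ψ (P (Θ x))` to `ψ (P (Θ (x + S e₀)))` CHRONOLOGICALLY (`P u = Λ u + c₀`): the line is the chart segment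
`P (Θ x) + s (c Λ e₀)`, it stays in the certified tube (radius constant, time `+ c s`), its velocity is timelike by
pinching (`g_A(Θ ·)(c e₀, c e₀) = −1 + 2H ≤ −δ`) and future by (ii) + `adapted_smul_basisVector_future`.
Dafermos–Rodnianski arXiv:0811.0354, §5.1; O'Neill 1983, Ch. 14, pp. 402–403. [folklore] -/
theorem kerrTimeLine_mem_chronologicalFuture (hW : IsKerrChartedWith 𝓑 A M a c r₀ Θ)
    (hF5 : ∀ u ∈ (Kerr.exterior M a : Set E4), ∀ h : Θ u ∈ A.domain,
      𝓑.timeOrientation.IsFutureDirected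
        (mfderiv 𝓘(ℝ, E4) (𝓡 4) A.toFun ⟨Θ u, h⟩ (fderiv ℝ Θ u (Kerr.timeVector M a u))))
    (ψ : (A.background.boost Λ c₀).domain → 𝓢.carrier) (hψ : ContMDiff 𝓘(ℝ, E4) (𝓡 4) ∞ ψ) {τ₀ : ℝ}
    (hii : ∀ (y : (A.background.boost Λ c₀).domain) (w : E4), τ₀ < (A.background.boost Λ c₀).time y.1 →
      𝓑.timeOrientation.IsFutureDirected (mfderiv 𝓘(ℝ, E4) (𝓡 4) A.toFun
        ⟨poincareInv Λ c₀ y.1, ModelBackground.mem_boost_domain.1 y.2⟩ ((Λ : E4 ≃L[ℝ] E4).symm w)) →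
      𝓢.metric.IsTimelike (mfderiv 𝓘(ℝ, E4) (𝓡 4) ψ y w) →
        𝓢.timeOrientation.IsFutureDirected (mfderiv 𝓘(ℝ, E4) (𝓡 4) ψ y w))
    {k : ℕ} {R : ℝ → ℝ} (hRm : Monotone R) {ε δ T : ℝ} (hε : 0 < ε)
    (hεδ : ε * ‖c • (Λ : E4 ≃L[ℝ] E4) (E4.basisVector 0)‖ ^ 2 < δ)
    (hdev : ∀ τ, T ≤ τ → 𝓢.truncDeviationCk (A.background.boost Λ c₀) ψ k (R τ) τ < ENNReal.ofReal ε)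
    {x : E4} (hx : x ∈ (Kerr.exterior M a : Set E4)) (hH : 2 * Kerr.scalarH M a x ≤ 1 - δ)
    (hT : T ≤ Θ x 0) (hτ₀ : τ₀ < Θ x 0) (hRx : A.radius (Θ x) ≤ R (Θ x 0)) {S : ℝ} (hS : 0 < S)
    (h₀ : (Λ : E4 ≃L[ℝ] E4) (Θ x) + c₀ ∈ (A.background.boost Λ c₀).domain)
    (h₁ : (Λ : E4 ≃L[ℝ] E4) (Θ (x + S • E4.basisVector 0)) + c₀ ∈ (A.background.boost Λ c₀).domain) :
    ψ ⟨(Λ : E4 ≃L[ℝ] E4) (Θ (x + S • E4.basisVector 0)) + c₀, h₁⟩ ∈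
      𝓢.metric.chronologicalFuture 𝓢.timeOrientation {ψ ⟨(Λ : E4 ≃L[ℝ] E4) (Θ x) + c₀, h₀⟩} := by
  obtain ⟨hsub, hc, -, hr₀, hΘs, -, hΘm, hΘe, hiso, -, -⟩ := id hW
  have hsubreg : (Kerr.exterior M a : Set E4) ⊆ (Kerr.region a r₀ : Set E4) := fun y hy ↦
    Kerr.mem_region.2 ((max_le_max hr₀.le le_rfl).trans_lt (Kerr.mem_exterior.1 hy))
  -- opaque names for the direction `v = c Λ e₀` and the base point `z = P (Θ x)` of the chart segment
  obtain ⟨v, hv⟩ : ∃ v : E4, v = c • (Λ : E4 ≃L[ℝ] E4) (E4.basisVector 0) := ⟨_, rfl⟩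
  obtain ⟨z, hz⟩ : ∃ z : E4, z = (Λ : E4 ≃L[ℝ] E4) (Θ x) + c₀ := ⟨_, rfl⟩
  -- the Kerr–Schild time line and its image
  have hxs : ∀ s : ℝ, x + s • E4.basisVector 0 ∈ (Kerr.exterior M a : Set E4) := fun s ↦
    Kerr.add_smul_basisVector_zero_mem_region hx s
  have hΘxs : ∀ s : ℝ, Θ (x + s • E4.basisVector 0) = Θ x + (c * s) • E4.basisVector 0 := fun s ↦
    hΘe x (hsubreg hx) s
  have hseg : ∀ s : ℝ, z + s • v = (Λ : E4 ≃L[ℝ] E4) (Θ (x + s • E4.basisVector 0)) + c₀ := fun s ↦ by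
    rw [hz, hv, hΘxs s, map_add, map_smul, smul_smul, mul_comm s c]
    abel
  have hP : ∀ s : ℝ, poincareInv Λ c₀ (z + s • v) = Θ (x + s • E4.basisVector 0) := fun s ↦ by
    rw [hseg, poincareInv_apply_add]
  have hmem : ∀ s : ℝ, z + s • v ∈ ((A.background.boost Λ c₀).domain : Set E4) := fun s ↦ by
    show poincareInv Λ c₀ (z + s • v) ∈ (A.domain : Set E4)
    rw [hP]
    exact hΘm (hsubreg (hxs s))
  have htime : ∀ s : ℝ, (A.background.boost Λ c₀).time (z + s • v) = Θ x 0 + c * s := fun s ↦ by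
    show (poincareInv Λ c₀ (z + s • v)) 0 = _
    rw [hP, hΘxs]
    simp [E4.basisVector]
  have hradius : ∀ s : ℝ, (A.background.boost Λ c₀).radius (z + s • v) = A.radius (Θ x) := fun s ↦ by
    show A.radius (poincareInv Λ c₀ (z + s • v)) = _
    rw [hP, hΘxs, adaptedRadius_add_smul_basisVector]
  have hsymm : (Λ : E4 ≃L[ℝ] E4).symm v = c • E4.basisVector 0 := by
    rw [hv, map_smul, ContinuousLinearEquiv.symm_apply_apply]
  have hH' : ∀ s : ℝ, 2 * Kerr.scalarH M a (x + s • E4.basisVector 0) ≤ 1 - δ := fun s ↦ by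
    rwa [Kerr.scalarH_add_smul_basisVector_zero]
  have hcs : ∀ s : ℝ, 0 ≤ s → Θ x 0 ≤ Θ x 0 + c * s := fun s hs ↦ le_add_of_nonneg_right (mul_nonneg hc.le hs)
  have hεv : ε * ‖v‖ ^ 2 < δ := by rw [hv]; exact hεδ
  have hδ : 0 < δ := lt_of_le_of_lt (by positivity) hεv
  -- background length of `v` along the line: `g_A(Θ x_s)(c e₀, c e₀) = g_{M,a}(x_s)(e₀, e₀) = -1 + 2H`
  have hbilin : ∀ s : ℝ, (A.background.boost Λ c₀).bilin (z + s • v) v v =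
      -1 + 2 * Kerr.scalarH M a (x + s • E4.basisVector 0) := fun s ↦ by
    rw [ModelBackground.boost_bilin_apply, StationaryAFBlackHole.AdaptedChart.background_bilin, hsymm, hP,
      ← fderiv_apply_basisVector_zero_of_contDiffOn (Kerr.region a r₀).isOpen (by simp) hΘs hΘe (hsubreg (hxs s)),
      hiso _ (hxs s), Kerr.bilin_basisVector_zero_basisVector_zero]
  -- pointwise along the segment: pinching, timelikeness, futureness
  have hdev' : ∀ s : ℝ, 0 ≤ s → ‖𝓢.deviation (A.background.boost Λ c₀) ψ ⟨z + s • v, hmem s⟩‖ < ε := by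
    intro s hs
    refine norm_deviation_lt_of_truncDeviationCk_lt_w3 𝓢 (A.background.boost Λ c₀) ψ hε
      (hdev ((A.background.boost Λ c₀).time (z + s • v)) ?_) ⟨rfl, ?_⟩
    · rw [htime]; exact hT.trans (hcs s hs)
    · rw [hradius, htime]; exact hRx.trans (hRm (hcs s hs))
  have htl : ∀ s : ℝ, 0 ≤ s →
      𝓢.metric.IsTimelike (mfderiv 𝓘(ℝ, E4) (𝓡 4) ψ ⟨z + s • v, hmem s⟩ v) := fun s hs ↦
    isTimelike_mfderiv_of_norm_deviation_le_w3 𝓢 (A.background.boost Λ c₀) ψ (hdev' s hs).le (by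
      rw [hbilin]; linarith [hH' s, hεv])
  have hfut : ∀ s : ℝ, 0 ≤ s →
      𝓢.timeOrientation.IsFutureDirected (mfderiv 𝓘(ℝ, E4) (𝓡 4) ψ ⟨z + s • v, hmem s⟩ v) := by
    intro s hs
    refine hii ⟨z + s • v, hmem s⟩ v (by rw [htime]; exact hτ₀.trans_le (hcs s hs)) ?_ (htl s hs)
    have key : ∀ (q : E4) (hq : q ∈ A.domain), q = Θ (x + s • E4.basisVector 0) →
        𝓑.timeOrientation.IsFutureDirected (mfderiv 𝓘(ℝ, E4) (𝓡 4) A.toFun ⟨q, hq⟩ (c • E4.basisVector 0)) := by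
      rintro q hq rfl
      exact (adapted_smul_basisVector_future A hW hF5 (hxs s) (by linarith [hH' s, hδ]) hq).2
    rw [hsymm]
    exact key _ _ (hP s)
  -- the chart-segment glue, through the parametrisation `ψ ∘ (chartAt E4 y₀).symm`
  have hz0 : z ∈ ((A.background.boost Λ c₀).domain : Set E4) := by simpa using hmem 0
  set y₀ : (A.background.boost Λ c₀).domain := ⟨z, hz0⟩ with hy₀
  set Φ : E4 → 𝓢.carrier := ψ ∘ (chartAt E4 y₀).symm with hΦ
  have hΦq : ∀ (q : E4) (hq : q ∈ ((A.background.boost Λ c₀).domain : Set E4)), Φ q = ψ ⟨q, hq⟩ := fun q hq ↦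
    congrFun (Spacetime.comp_chartAt_symm_comp_subtypeVal ψ y₀) ⟨q, hq⟩
  have hmd : ∀ s : ℝ, MDifferentiableAt 𝓘(ℝ, E4) (𝓡 4) ψ ⟨z + s • v, hmem s⟩ := fun s ↦
    hψ.mdifferentiableAt (by simp)
  have hI := stub_chartSegment_chronological 𝓢 Φ ((A.background.boost Λ c₀).domain : Set E4) z v S
    (A.background.boost Λ c₀).domain.isOpen (𝓢.contMDiffOn_comp_chartAt_symm (A.background.boost Λ c₀) ψ y₀ hψ)
    hS (fun s _ ↦ hmem s)
    (fun s hs ↦ by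
      rw [𝓢.metricInCoords_comp_chartAt_symm_apply (A.background.boost Λ c₀) ψ y₀ (hmem s) (hmd s)]
      exact htl s hs.1)
    (fun s hs ↦ by
      rw [𝓢.mfderiv_comp_chartAt_symm_apply (A.background.boost Λ c₀) ψ y₀ (hmem s) (hmd s), hΦq _ (hmem s)]
      exact hfut s hs.1)
  rw [hΦq (z + S • v) (hmem S), hΦq z hz0] at hI
  have e1 : (⟨z + S • v, hmem S⟩ : (A.background.boost Λ c₀).domain) =
      ⟨(Λ : E4 ≃L[ℝ] E4) (Θ (x + S • E4.basisVector 0)) + c₀, h₁⟩ := Subtype.ext (hseg S)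
  have e0 : (⟨z, hz0⟩ : (A.background.boost Λ c₀).domain) = ⟨(Λ : E4 ≃L[ℝ] E4) (Θ x) + c₀, h₀⟩ := Subtype.ext hz
  rw [e1, e0] at hI
  exact hI

end Line

/-! ## §4 The decomposition: far tube points flow into the recut certified slab -/

/-- **Registered helper `recutJunction_holeTube_far` (stub `stub_recutJunctionCoreOriented`, ingredient (α)).**
For a stationary decomposition `d` with Kerr identifications `Θᵢ` (`IsKerrChartedWith`), radii `Rᵢ` MONOTONE with
`truncDeviationCk (d.background i) (d.toOver.chart i) k (Rᵢ τ) τ → 0` (clause (i)), future-preserving `Θᵢ` (F5) and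
the orientation clause (ii): for every hole `i` and margin `δ > 0` there is a chart time `T` such that for every
Kerr–Schild exterior point `x` OUTSIDE THE ERGOREGION WITH MARGIN (`2H(x) ≤ 1 − δ`) whose chart point
`ψᵢ (Pᵢ (Θᵢ x))` is certified (`(Θᵢ x)⁰ ≥ T`, `Aᵢ.radius (Θᵢ x) ≤ Rᵢ ((Θᵢ x)⁰)`), and every `S ≥ 0`, the chart
point of `x` lies in the CAUSAL PAST of the chart point of `x + S e₀` (the Kerr–Schild time line is a future
timelike chart segment, `kerrTimeLine_mem_chronologicalFuture`). [folklore] -/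
theorem recutJunction_holeTube_far : ∀ {𝓢 : Spacetime.{0} 4} {O : Set 𝓢.carrier} {k : ℕ} (d : StationaryFinalStateDecomposition 𝓢 O k) (M a c r₀ : Fin d.N → ℝ) (Θ : Fin d.N → E4 → E4) (R : Fin d.N → ℝ → ℝ), (∀ i, Filter.Tendsto (fun τ ↦ 𝓢.truncDeviationCk (d.background i) (d.toOver.chart i) k (R i τ) τ) Filter.atTop (nhds 0)) → (∀ i, Monotone (R i)) → (∀ i, IsKerrChartedWith (d.hole i) (d.adapted i) (M i) (a i) (c i) (r₀ i) (Θ i)) → (∀ i, ∀ u ∈ (Kerr.exterior (M i) (a i) : Set E4), ∀ h : Θ i u ∈ (d.adapted i).domain, (d.hole i).timeOrientation.IsFutureDirected (mfderiv 𝓘(ℝ, E4) (𝓡 4) (d.adapted i).toFun ⟨Θ i u, h⟩ (fderiv ℝ (Θ i) u (Kerr.timeVector (M i) (a i) u)))) → (∀ (i : Fin d.N) (y : (d.background i).domain) (w : E4), d.toOver.τ₀ < (d.background i).time y.1 → (d.hole i).timeOrientation.IsFutureDirected (mfderiv 𝓘(ℝ, E4) (𝓡 4) (d.adapted i).toFun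 ⟨poincareInv (d.motion i).1 (d.motion i).2 y.1, ModelBackground.mem_boost_domain.1 y.2⟩ (((d.motion i).1 : E4 ≃L[ℝ] E4).symm w)) → 𝓢.metric.IsTimelike (mfderiv 𝓘(ℝ, E4) (𝓡 4) (d.toOver.chart i) y w) → 𝓢.timeOrientation.IsFutureDirected (mfderiv 𝓘(ℝ, E4) (𝓡 4) (d.toOver.chart i) y w)) → ∀ (i : Fin d.N) (δ : ℝ), 0 < δ → ∃ T : ℝ, ∀ x ∈ (Kerr.exterior (M i) (a i) : Set E4), 2 * Kerr.scalarH (M i) (a i) x ≤ 1 - δ → T ≤ Θ i x 0 → (d.adapted i).radius (Θ i x) ≤ R i (Θ i x 0) → ∀ S : ℝ, 0 ≤ S → ∀ (h₀ : ((d.motion i).1 : E4 ≃L[ℝ] E4) (Θ i x) + (d.motion i).2 ∈ (d.background i).domain) (h₁ : ((d.motion i).1 : E4 ≃L[ℝ] E4) (Θ i (x + S • E4.basisVector 0)) + (d.motion i).2 ∈ (d.background i).domain), d.toOver.chart i ⟨((d.motion i).1 : E4 ≃L[ℝ] E4) (Θ i x) + (d.motion i).2, h₀⟩ ∈ 𝓢.metric.causalPast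 𝓢.timeOrientation {d.toOver.chart i ⟨((d.motion i).1 : E4 ≃L[ℝ] E4) (Θ i (x + S • E4.basisVector 0)) + (d.motion i).2, h₁⟩} := by
  intro 𝓢 O k d M a c r₀ Θ R hRi hRm hW hF5 hii i δ hδ
  -- the pinching level `ε` with `ε ‖cᵢ Λᵢ e₀‖² < δ`, reached after chart time `T₁`
  set w : E4 := c i • ((d.motion i).1 : E4 ≃L[ℝ] E4) (E4.basisVector 0) with hw
  set ε : ℝ := δ / (2 * (‖w‖ ^ 2 + 1)) with hε_def
  have hε : 0 < ε := by positivity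
  have hεδ : ε * ‖w‖ ^ 2 < δ := by
    rw [hε_def, div_mul_eq_mul_div, div_lt_iff₀ (by positivity)]
    nlinarith [norm_nonneg w]
  obtain ⟨T₁, hT₁⟩ := Filter.eventually_atTop.1 ((hRi i).eventually (gt_mem_nhds (ENNReal.ofReal_pos.2 hε)))
  refine ⟨max T₁ (d.toOver.τ₀ + 1), fun x hx hH hT hRx S hS h₀ h₁ ↦ ?_⟩
  have hT₁x : T₁ ≤ Θ i x 0 := (le_max_left _ _).trans hT
  have hτ₀ : d.toOver.τ₀ < Θ i x 0 := (lt_add_one _).trans_le ((le_max_right _ _).trans hT)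
  rcases hS.eq_or_lt with rfl | hS'
  · have h : (⟨((d.motion i).1 : E4 ≃L[ℝ] E4) (Θ i (x + (0 : ℝ) • E4.basisVector 0)) + (d.motion i).2, h₁⟩ :
        (d.background i).domain) = ⟨((d.motion i).1 : E4 ≃L[ℝ] E4) (Θ i x) + (d.motion i).2, h₀⟩ := by
      apply Subtype.ext; simp
    have hpt : d.toOver.chart i ⟨((d.motion i).1 : E4 ≃L[ℝ] E4) (Θ i (x + (0 : ℝ) • E4.basisVector 0)) +
        (d.motion i).2, h₁⟩ = d.toOver.chart i ⟨((d.motion i).1 : E4 ≃L[ℝ] E4) (Θ i x) + (d.motion i).2, h₀⟩ :=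
      congrArg (d.toOver.chart i) h
    rw [hpt]
    exact LorentzianMetric.subset_causalPast _ _ _ (mem_singleton _)
  · exact LorentzianMetric.mem_causalPast_of_mem_causalFuture
      (LorentzianMetric.chronologicalFuture_subset_causalFuture _ _ _
        (kerrTimeLine_mem_chronologicalFuture 𝓢 (d.adapted i) (d.motion i).1 (d.motion i).2 (hW i) (hF5 i)
          (d.toOver.chart i) (d.toOver.isLateChart i).contMDiff (hii i) (hRm i) hε hεδ hT₁ hx hH hT₁x hτ₀ hRx
          hS' h₀ h₁))

/-- **Slab form of ingredient (α)** (`recutJunction_holeTube_far_slab`): with `T` as above, a far certified chart point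
of Kerr–Schild time `x⁰ ≤ τ₁` and Kerr–Schild radius `r(x) ≤ R' i τ₁` lies in `J⁻(recutCertifiedSlab d M a Θ R' τ₁)`,
for EVERY radius function `R'` (flow for the Kerr–Schild time `S = τ₁ − x⁰`; the endpoint is the recut chart point of
the boosted Kerr–Schild point `Pᵢ (x + S e₀)`, of rest-frame time `τ₁` and radius `r(x)`). [folklore] -/
theorem recutJunction_holeTube_far_slab {𝓢 : Spacetime.{0} 4} {O : Set 𝓢.carrier} {k : ℕ}
    (d : StationaryFinalStateDecomposition 𝓢 O k) (M a c r₀ : Fin d.N → ℝ) (Θ : Fin d.N → E4 → E4)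
    (R : Fin d.N → ℝ → ℝ)
    (hRi : ∀ i, Tendsto (fun τ ↦ 𝓢.truncDeviationCk (d.background i) (d.toOver.chart i) k (R i τ) τ) atTop (𝓝 0))
    (hRm : ∀ i, Monotone (R i))
    (hW : ∀ i, IsKerrChartedWith (d.hole i) (d.adapted i) (M i) (a i) (c i) (r₀ i) (Θ i))
    (hF5 : ∀ i, ∀ u ∈ (Kerr.exterior (M i) (a i) : Set E4), ∀ h : Θ i u ∈ (d.adapted i).domain,
      (d.hole i).timeOrientation.IsFutureDirected
        (mfderiv 𝓘(ℝ, E4) (𝓡 4) (d.adapted i).toFun ⟨Θ i u, h⟩ (fderiv ℝ (Θ i) u (Kerr.timeVector (M i) (a i) u))))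
    (hii : ∀ (i : Fin d.N) (y : (d.background i).domain) (w : E4), d.toOver.τ₀ < (d.background i).time y.1 →
      (d.hole i).timeOrientation.IsFutureDirected
          (mfderiv 𝓘(ℝ, E4) (𝓡 4) (d.adapted i).toFun
            ⟨poincareInv (d.motion i).1 (d.motion i).2 y.1, ModelBackground.mem_boost_domain.1 y.2⟩
            (((d.motion i).1 : E4 ≃L[ℝ] E4).symm w)) →
        𝓢.metric.IsTimelike (mfderiv 𝓘(ℝ, E4) (𝓡 4) (d.toOver.chart i) y w) →
          𝓢.timeOrientation.IsFutureDirected (mfderiv 𝓘(ℝ, E4) (𝓡 4) (d.toOver.chart i) y w))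
    (i : Fin d.N) {δ : ℝ} (hδ : 0 < δ) :
    ∃ T : ℝ, ∀ (R' : Fin d.N → ℝ → ℝ) (τ₁ : ℝ), ∀ x ∈ (Kerr.exterior (M i) (a i) : Set E4),
      2 * Kerr.scalarH (M i) (a i) x ≤ 1 - δ → T ≤ Θ i x 0 → (d.adapted i).radius (Θ i x) ≤ R i (Θ i x 0) →
      x 0 ≤ τ₁ → Kerr.radius (a i) x ≤ R' i τ₁ →
      ∀ h₀ : ((d.motion i).1 : E4 ≃L[ℝ] E4) (Θ i x) + (d.motion i).2 ∈ (d.background i).domain,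
        d.toOver.chart i ⟨((d.motion i).1 : E4 ≃L[ℝ] E4) (Θ i x) + (d.motion i).2, h₀⟩ ∈
          𝓢.metric.causalPast 𝓢.timeOrientation (recutCertifiedSlab d M a Θ R' τ₁) := by
  obtain ⟨T, hT⟩ := recutJunction_holeTube_far d M a c r₀ Θ R hRi hRm hW hF5 hii i δ hδ
  refine ⟨T, fun R' τ₁ x hx hH hTx hRx hx0 hrad h₀ ↦ ?_⟩
  obtain ⟨-, -, -, hr₀, -, -, hΘm, -, -, -, -⟩ := hW i
  have hsubreg : (Kerr.exterior (M i) (a i) : Set E4) ⊆ (Kerr.region (a i) (r₀ i) : Set E4) := fun y hy ↦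
    Kerr.mem_region.2 ((max_le_max hr₀.le le_rfl).trans_lt (Kerr.mem_exterior.1 hy))
  set S : ℝ := τ₁ - x 0 with hS_def
  have hS : 0 ≤ S := sub_nonneg.2 hx0
  have hxS : x + S • E4.basisVector 0 ∈ (Kerr.exterior (M i) (a i) : Set E4) :=
    Kerr.add_smul_basisVector_zero_mem_region hx S
  -- the endpoint: the recut chart point of `z = Pᵢ (x + S e₀)`, rest-frame time `τ₁`, radius `r(x)`
  set z : E4 := ((d.motion i).1 : E4 ≃L[ℝ] E4) (x + S • E4.basisVector 0) + (d.motion i).2 with hz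
  have hPz : poincareInv (d.motion i).1 (d.motion i).2 z = x + S • E4.basisVector 0 := poincareInv_apply_add _ _ _
  have hzdom : z ∈ ((recutBackground d M a i).domain : Set E4) := by
    show poincareInv (d.motion i).1 (d.motion i).2 z ∈ (Kerr.exterior (M i) (a i) : Set E4)
    rw [hPz]; exact hxS
  have h₁ : ((d.motion i).1 : E4 ≃L[ℝ] E4) (Θ i (x + S • E4.basisVector 0)) + (d.motion i).2 ∈ (d.background i).domain := by
    show poincareInv (d.motion i).1 (d.motion i).2 _ ∈ ((d.adapted i).domain : Set E4)
    rw [poincareInv_apply_add]; exact hΘm (hsubreg hxS)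
  have hend : d.toOver.chart i ⟨((d.motion i).1 : E4 ≃L[ℝ] E4) (Θ i (x + S • E4.basisVector 0)) + (d.motion i).2, h₁⟩ ∈
      recutCertifiedSlab d M a Θ R' τ₁ := by
    refine Or.inr (mem_iUnion.2 ⟨i, mem_image_of_mem _ ?_⟩)
    refine ⟨z, ⟨⟨z, hzdom⟩, ⟨?_, ?_⟩, rfl⟩, ?_⟩
    · show (poincareInv (d.motion i).1 (d.motion i).2 z) 0 = τ₁
      rw [hPz, hS_def]; simp [E4.basisVector]
    · show Kerr.radius (a i) (poincareInv (d.motion i).1 (d.motion i).2 z) ≤ R' i τ₁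
      rw [hPz, Kerr.radius_add_time_smul_basisVector]; exact hrad
    · show ((d.motion i).1 : E4 ≃L[ℝ] E4) (Θ i (poincareInv (d.motion i).1 (d.motion i).2 z)) + (d.motion i).2 = _
      rw [hPz]
  exact LorentzianMetric.causalFuture_mono (singleton_subset_iff.2 hend) (hT x hx hH hTx hRx S hS h₀ h₁)

end Summit.FinalStateConjecture.FinalStateConjecture.Theorems.SymplecticDualOfTheBomb

end
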